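import Summits.CriticalPhenomena.PercolationContinuityZ3.Theorems.PercNearOneGluingNoHeavyLowerTailSahiTangentPairExpansion
import Literature.Combinatorics.Sahi2008.UniformSquareAllOrders
import Literature.Combinatorics.Sahi2008.GeneratingFunction
import Literature.Combinatorics.Sahi2008.Indicators

/-!
# `NoHeavyLowerTail` (crux stmt-CriticalPhenomena-4575), Sahi programme: consequences of the coin expansion — **THE EXCESS OVER THE CHORD,
# THE MONOTONE-CORRELATION CRITERION FOR CONJECTURE T_n, AND CONJECTURE T_n AT EVERY VERTEX, AT EVERY ORDER**

Support file (Sahi cell, seat `prim-sahi-p1`, generation 51; `--supports stmt-CriticalPhenomena-4575`).  Companion of `…SahiTangentPairExpansion`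
(`sahiE_coin_pair`: `E_{n+1}^{B_s⊗μ}(ε ? g¹ : g⁰) = Σ_c Σ_χ ψ_{cT,cF}(s)·Π_B cbf`).  Pure proofs, no definitions, no `sorry`, standard axioms.

CONJECTURE T_n (memo FROM-prim-sahi-p2-gen32-TANGENT / FROM-prim-sahi-p1-gen50, all-orders form): for a pair family `F_l = ε ? g¹_l : g⁰_l` with
`g⁰_l ≤ g¹_l` on the coin space (`B_s ⊗ μ`), `s·E_n^{μ}(g¹) ≤ E_n^{B_s⊗μ}(F)` — in percolation, `E_n(A_l) ≥ p_e·E_n(A_l | e open)` for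
increasing events along an independent edge `e`.  FALSE in general already at `n = 3` (census W161); true at every order for cylinder pairs under
product measures (gen 50, `sahiE_coin_cylinders_ge`).  THIS FILE, from the exact expansion:
* §2 `sahiE_coin_pair_sub_chord`: **`E^{B_s⊗μ}(F) − [s·E(g¹) + (1−s)·E(g⁰)] = Σ_{c : ≥ 2 blocks} Σ_χ ψ_{cT,cF}(s) Π_B cbf`** (the one-block
  terms are exactly the chord; proved by evaluating the expansion at `s = 1` and `s = 0`, where all `ψ_{i,j}` with `i + j ≥ 2` vanish).
* §3 **MONOTONE-CORRELATION CRITERION** (`chord_le_sahiE_coin_pair`, `mul_sahiE_le_sahiE_coin_pair`): if every PROPER sub-family satisfies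
  `0 ≤ E_m^{μ}(g⁰|_B) ≤ E_m^{μ}(g¹|_B)` then `s·E(g¹) + (1−s)·E(g⁰) ≤ E^{B_s⊗μ}(F)`, and with `E_{n+1}(g⁰) ≥ 0` Conjecture T_{n+1} holds for the
  pair.  READING: Conjecture T can only fail through a sub-family whose Sahi functional DECREASES from the bottom section to the top section
  (e.g. a covariance: `Cov` is not monotone in the events — the W161 mechanism, cf. gen-50 memo §6 "∂T₃/∂X₀ indefinite"), or through
  negativity of a bottom sub-family functional.
* §4 **CONJECTURE T_n AT EVERY VERTEX, EVERY ORDER** (`mul_sahiE_le_sahiE_coin_vertex`): for ANY nonempty set `L` of top-only slots (`ε·f_l`;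
  the others plain `f_l`), `s·E_{n+1}^{μ}(f) ≤ E_{n+1}^{B_s⊗μ}(F^L)` as soon as the proper sub-families of `f` have `E_m ≥ 0` (any weight, any
  functions) — the bottom sections `[l ∉ L]·f_l` satisfy the criterion trivially (a sub-family meeting `L` has a zero slot).  `L = univ` is
  V_∅ (`…SahiTangentScalingVertex`); gen 50 proved orders `≤ 5` unconditionally under FKG at all vertices by Harris certificates.
* §4b DAMPED PAIRS (`mul_sahiE_le_sahiE_coin_damped`): bottoms `κ_l·f_l`, `κ_l ∈ [0,1]` (gen-50 memo §5 "separable slots", now every order).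
* §5 the Sahi-positive / FKG up-set forms (hypothesis `SahiPositive μ n` only).
Nothing conjectural is asserted. [this work]
-/

namespace Summit.CriticalPhenomena.PercolationContinuityZ3.Theorems.SahiTangent

open Finset Function Literature.Combinatorics.Sahi2008
open scoped BigOperators

noncomputable section

variable {α : Type*} [Fintype α] {n : ℕ}

/-! ### §1 Boundary values of the coefficients (`s = 0`, `s = 1`) -/

/-- `φ_k(0) = 0` for `k ≥ 1`. [this work] -/
theorem scalingCoeff_zero_succ : ∀ k : ℕ, scalingCoeff 0 (k + 1) = 0
  | 0 => by rw [scalingCoeff_one]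
  | k + 1 => by rw [scalingCoeff_succ, scalingCoeff_zero_succ k, mul_zero]

/-- At `s = 1` only the one-block coefficients survive: `ψ_{i,j}(1) = 0` for `i + j ≥ 2`. [this work] -/
theorem pairCoeff_one_eq_zero : ∀ i j : ℕ, 2 ≤ i + j → pairCoeff 1 i j = 0
  | 0, j, h => by rw [pairCoeff_zero_left, if_neg (by omega)]
  | 1, j, h => by rw [pairCoeff_one_left, if_neg (by omega)]
  | i + 2, j, _ => by rw [pairCoeff_add_two, scalingCoeff_one_add_two, zero_mul]

/-- At `s = 0` likewise: `ψ_{i,j}(0) = 0` for `i + j ≥ 2`. [this work] -/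
theorem pairCoeff_zero_eq_zero : ∀ i j : ℕ, 2 ≤ i + j → pairCoeff 0 i j = 0
  | 0, j, h => by rw [pairCoeff_zero_left, if_neg (by omega)]
  | 1, j, h => by rw [pairCoeff_one_left]; split_ifs <;> rfl
  | i + 2, j, _ => by rw [pairCoeff_add_two, show i + 2 = (i + 1) + 1 from rfl, scalingCoeff_zero_succ, zero_mul]

/-- The chord combination of the coefficients: `ψ_{i,j}(s) − s·ψ_{i,j}(1) − (1−s)·ψ_{i,j}(0)` vanishes on one block and is `ψ_{i,j}(s)`
on `≥ 2` blocks. [this work] -/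
theorem pairCoeff_chord (s : ℝ) : ∀ i j : ℕ, 1 ≤ i + j →
    pairCoeff s i j - s * pairCoeff 1 i j - (1 - s) * pairCoeff 0 i j = if 2 ≤ i + j then pairCoeff s i j else 0
  | 0, 0, h => by omega
  | 0, 1, _ => by norm_num [pairCoeff_zero_left]
  | 1, 0, _ => by norm_num [pairCoeff_one_left]
  | 0, j + 2, _ => by rw [pairCoeff_one_eq_zero 0 (j + 2) (by omega), pairCoeff_zero_eq_zero 0 (j + 2) (by omega), if_pos (by omega)]; ring
  | 1, j + 1, _ => by rw [pairCoeff_one_eq_zero 1 (j + 1) (by omega), pairCoeff_zero_eq_zero 1 (j + 1) (by omega), if_pos (by omega)]; ring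
  | i + 2, j, _ => by
    rw [pairCoeff_one_eq_zero (i + 2) j (by omega), pairCoeff_zero_eq_zero (i + 2) j (by omega), if_pos (by omega)]; ring

/-! ### §2 The pair family at `s = 1` and `s = 0`; the excess over the chord -/

omit [Fintype α] in
/-- A product of pair slots is the pair slot of the products. [this work] -/
theorem prod_pairSlot {ι : Type*} (S : Finset ι) (g₁ g₀ : ι → α → ℝ) :
    ∏ i ∈ S, (fun z : Bool × α => if z.1 then g₁ i z.2 else g₀ i z.2) =
      fun z : Bool × α => if z.1 then (∏ i ∈ S, g₁ i) z.2 else (∏ i ∈ S, g₀ i) z.2 := by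
  funext z
  rcases z with ⟨b, x⟩
  rw [Finset.prod_apply]
  cases b <;> simp only [Bool.false_eq_true, if_false, if_true, Finset.prod_apply]

/-- At `s = 1` the coin family has the functionals of the TOP sections. [this work] -/
theorem sahiE_coin_pair_at_one (μ : α → ℝ) (n : ℕ) (g₁ g₀ : Fin n → α → ℝ) :
    sahiE (fun z : Bool × α => if z.1 then (1 : ℝ) * μ z.2 else (1 - 1) * μ z.2) n
      (fun l (z : Bool × α) => if z.1 then g₁ l z.2 else g₀ l z.2) = sahiE μ n g₁ := by
  refine sahiE_congr_of_moments _ _ n _ _ fun S _ => ?_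
  rw [prod_pairSlot, ex_coin_pair]; ring

/-- At `s = 0` the coin family has the functionals of the BOTTOM sections. [this work] -/
theorem sahiE_coin_pair_at_zero (μ : α → ℝ) (n : ℕ) (g₁ g₀ : Fin n → α → ℝ) :
    sahiE (fun z : Bool × α => if z.1 then (0 : ℝ) * μ z.2 else (1 - 0) * μ z.2) n
      (fun l (z : Bool × α) => if z.1 then g₁ l z.2 else g₀ l z.2) = sahiE μ n g₀ := by
  refine sahiE_congr_of_moments _ _ n _ _ fun S _ => ?_
  rw [prod_pairSlot, ex_coin_pair]; ring

/-- **THE EXCESS OVER THE CHORD.**  For every weight `μ`, real `s`, and pair family: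
`E_{n+1}^{B_s⊗μ}(ε ? g¹ : g⁰) − [s·E_{n+1}^{μ}(g¹) + (1−s)·E_{n+1}^{μ}(g⁰)] = Σ_{c : ≥ 2 blocks} Σ_χ ψ_{cT,cF}(s)·Π_B cbf`
(the one-block terms are exactly the chord). [this work] -/
theorem sahiE_coin_pair_sub_chord (μ : α → ℝ) (s : ℝ) (n : ℕ) (g₁ g₀ : Fin (n + 1) → α → ℝ) :
    sahiE (fun z : Bool × α => if z.1 then s * μ z.2 else (1 - s) * μ z.2) (n + 1)
        (fun l (z : Bool × α) => if z.1 then g₁ l z.2 else g₀ l z.2) -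
      (s * sahiE μ (n + 1) g₁ + (1 - s) * sahiE μ (n + 1) g₀) =
      ∑ c : OrderedFinpartition (n + 1), ∑ χ : Fin c.length → Bool,
        if 2 ≤ c.length then pairTerm μ s g₁ g₀ c χ else 0 := by
  rw [← sahiE_coin_pair_at_one μ (n + 1) g₁ g₀, ← sahiE_coin_pair_at_zero μ (n + 1) g₁ g₀, sahiE_coin_pair, sahiE_coin_pair,
    sahiE_coin_pair]
  unfold pairSum
  rw [mul_sum, mul_sum, ← sum_add_distrib, ← sum_sub_distrib]
  refine sum_congr rfl fun c _ => ?_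
  rw [mul_sum, mul_sum, ← sum_add_distrib, ← sum_sub_distrib]
  refine sum_congr rfl fun χ _ => ?_
  have hlen : cT χ + cF χ = c.length := cT_add_cF χ
  have h := pairCoeff_chord s (cT χ) (cF χ) (by have := c.length_pos (Nat.succ_pos n); omega)
  unfold pairTerm
  rw [hlen] at h
  split_ifs at h ⊢ with h2
  · linear_combination (∏ m : Fin c.length, cbf μ g₁ g₀ c χ m) * h
  · linear_combination (∏ m : Fin c.length, cbf μ g₁ g₀ c χ m) * h

/-! ### §3 The monotone-correlation criterion for Conjecture T_n (all orders) -/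

/-- A summand on `≥ 2` blocks is nonnegative when every proper sub-family satisfies `0 ≤ E(g⁰|_B) ≤ E(g¹|_B)` and `0 ≤ s ≤ 1`.
[this work] -/
theorem pairTerm_nonneg (μ : α → ℝ) {s : ℝ} (hs0 : 0 ≤ s) (hs1 : s ≤ 1) (g₁ g₀ : Fin (n + 1) → α → ℝ)
    (h0 : ∀ m, m ≤ n → ∀ e : Fin m → Fin (n + 1), StrictMono e → 0 ≤ sahiE μ m (fun j => g₀ (e j)))
    (h01 : ∀ m, m ≤ n → ∀ e : Fin m → Fin (n + 1), StrictMono e → sahiE μ m (fun j => g₀ (e j)) ≤ sahiE μ m (fun j => g₁ (e j)))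
    (c : OrderedFinpartition (n + 1)) (hc : 2 ≤ c.length) (χ : Fin c.length → Bool) : 0 ≤ pairTerm μ s g₁ g₀ c χ := by
  unfold pairTerm
  refine mul_nonneg (pairCoeff_nonneg hs0 hs1 _ _) (prod_nonneg fun m _ => ?_)
  unfold cbf blockE
  have hm := partSize_le_of_two_le_length c hc m
  split_ifs
  · exact sub_nonneg.2 (h01 _ hm _ (c.emb_strictMono m))
  · exact h0 _ hm _ (c.emb_strictMono m)

/-- **MONOTONE-CORRELATION CRITERION FOR CONJECTURE T_n (every order).**  Let `μ` be any real weight, `0 ≤ s ≤ 1`, and `g¹, g⁰` two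
families of `n + 1` functions such that EVERY PROPER SUB-FAMILY (size `≤ n`, read increasingly) satisfies
`0 ≤ E_m^{μ}(g⁰|_B) ≤ E_m^{μ}(g¹|_B)`.  Then the coin functional dominates the chord:
`s·E_{n+1}^{μ}(g¹) + (1−s)·E_{n+1}^{μ}(g⁰) ≤ E_{n+1}^{B_s⊗μ}(ε ? g¹ : g⁰)`. [this work] -/
theorem chord_le_sahiE_coin_pair (μ : α → ℝ) {s : ℝ} (hs0 : 0 ≤ s) (hs1 : s ≤ 1) (g₁ g₀ : Fin (n + 1) → α → ℝ)
    (h0 : ∀ m, m ≤ n → ∀ e : Fin m → Fin (n + 1), StrictMono e → 0 ≤ sahiE μ m (fun j => g₀ (e j)))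
    (h01 : ∀ m, m ≤ n → ∀ e : Fin m → Fin (n + 1), StrictMono e → sahiE μ m (fun j => g₀ (e j)) ≤ sahiE μ m (fun j => g₁ (e j))) :
    s * sahiE μ (n + 1) g₁ + (1 - s) * sahiE μ (n + 1) g₀ ≤
      sahiE (fun z : Bool × α => if z.1 then s * μ z.2 else (1 - s) * μ z.2) (n + 1)
        (fun l (z : Bool × α) => if z.1 then g₁ l z.2 else g₀ l z.2) := by
  rw [← sub_nonneg, sahiE_coin_pair_sub_chord]
  refine sum_nonneg fun c _ => sum_nonneg fun χ _ => ?_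
  split_ifs with hc
  · exact pairTerm_nonneg μ hs0 hs1 g₁ g₀ h0 h01 c hc χ
  · exact le_rfl

/-- **CONJECTURE T_n UNDER THE CRITERION**: if moreover `E_{n+1}^{μ}(g⁰) ≥ 0`, then `s·E_{n+1}^{μ}(g¹) ≤ E_{n+1}^{B_s⊗μ}(ε ? g¹ : g⁰)`
— the contraction inequality "`E(A) ≥ p_e·E(A | e open)`" for the pair family. [this work] -/
theorem mul_sahiE_le_sahiE_coin_pair (μ : α → ℝ) {s : ℝ} (hs0 : 0 ≤ s) (hs1 : s ≤ 1) (g₁ g₀ : Fin (n + 1) → α → ℝ)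
    (h0 : ∀ m, m ≤ n → ∀ e : Fin m → Fin (n + 1), StrictMono e → 0 ≤ sahiE μ m (fun j => g₀ (e j)))
    (h01 : ∀ m, m ≤ n → ∀ e : Fin m → Fin (n + 1), StrictMono e → sahiE μ m (fun j => g₀ (e j)) ≤ sahiE μ m (fun j => g₁ (e j)))
    (hg₀ : 0 ≤ sahiE μ (n + 1) g₀) :
    s * sahiE μ (n + 1) g₁ ≤
      sahiE (fun z : Bool × α => if z.1 then s * μ z.2 else (1 - s) * μ z.2) (n + 1)
        (fun l (z : Bool × α) => if z.1 then g₁ l z.2 else g₀ l z.2) :=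
  le_trans (le_add_of_nonneg_right (mul_nonneg (sub_nonneg.2 hs1) hg₀)) (chord_le_sahiE_coin_pair μ hs0 hs1 g₁ g₀ h0 h01)

/-! ### §4 Every vertex of Conjecture T_n, at every order -/

/-- A family with a zero slot has `E_m = 0`. [folklore] -/
theorem sahiE_eq_zero_of_slot_eq_zero (μ : α → ℝ) {m : ℕ} (g : Fin m → α → ℝ) (j : Fin m) (hj : g j = 0) : sahiE μ m g = 0 := by
  have h := sahiE_update_zero μ g j
  rwa [← hj, update_eq_self] at h

/-- **CONJECTURE T_n AT EVERY VERTEX, EVERY ORDER, conditionally on Sahi positivity of the proper sub-families.**  For any real weight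
`μ`, `0 ≤ s ≤ 1`, a family `f` of `n + 1` functions all of whose proper sub-families have `E_m^{μ} ≥ 0`, and ANY nonempty set `L` of
slots made top-only (`ε·f_l`, the others plain `f_l` on both layers):
`s·E_{n+1}^{μ}(f) ≤ E_{n+1}^{B_s⊗μ}(F^L)`.  (`L = univ` is `mul_sahiE_le_sahiE_coin_topOnly`; `|L| = 1` is an equality; orders `≤ 5` are
unconditional under FKG, gen 50.) [this work] -/
theorem mul_sahiE_le_sahiE_coin_vertex (μ : α → ℝ) {s : ℝ} (hs0 : 0 ≤ s) (hs1 : s ≤ 1) (f : Fin (n + 1) → α → ℝ)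
    (L : Finset (Fin (n + 1))) (hL : L.Nonempty)
    (hpos : ∀ m, m ≤ n → ∀ e : Fin m → Fin (n + 1), StrictMono e → 0 ≤ sahiE μ m (fun j => f (e j))) :
    s * sahiE μ (n + 1) f ≤
      sahiE (fun z : Bool × α => if z.1 then s * μ z.2 else (1 - s) * μ z.2) (n + 1)
        (fun l (z : Bool × α) => if z.1 then f l z.2 else if l ∈ L then 0 else f l z.2) := by
  -- the vertex family is the pair family with bottom sections `g⁰_l = [l ∉ L]·f_l`
  set g₀ : Fin (n + 1) → α → ℝ := fun l => if l ∈ L then 0 else f l with hg₀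
  have hfam : (fun l (z : Bool × α) => if z.1 then f l z.2 else if l ∈ L then (0 : ℝ) else f l z.2) =
      fun l (z : Bool × α) => if z.1 then f l z.2 else g₀ l z.2 := by
    funext l z
    simp only [hg₀]
    split_ifs <;> rfl
  rw [hfam]
  -- a sub-family of the bottoms is either a sub-family of `f` or has a zero slot
  have hsub : ∀ m (e : Fin m → Fin (n + 1)),
      (fun j => g₀ (e j)) = (fun j => f (e j)) ∨ sahiE μ m (fun j => g₀ (e j)) = 0 := by
    intro m e
    by_cases h : ∃ j, e j ∈ L
    · obtain ⟨j, hj⟩ := h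
      right
      exact sahiE_eq_zero_of_slot_eq_zero μ _ j (by simp only [hg₀, if_pos hj])
    · left
      push Not at h
      funext j
      simp only [hg₀, if_neg (h j)]
  refine mul_sahiE_le_sahiE_coin_pair μ hs0 hs1 f g₀ (fun m hm e he => ?_) (fun m hm e he => ?_) ?_
  · rcases hsub m e with h | h
    · rw [h]; exact hpos m hm e he
    · rw [h]
  · rcases hsub m e with h | h
    · rw [h]
    · rw [h]; exact hpos m hm e he
  · obtain ⟨l, hl⟩ := hL
    rw [sahiE_eq_zero_of_slot_eq_zero μ g₀ l (by simp only [hg₀, if_pos hl])]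


/-! ### §4b Damped pairs -/

/-- **Damped pairs, every order**: bottoms `κ_l·g_l` with `0 ≤ κ_l ≤ 1`; if all sub-families of `g` (including `g`) have `E_m^{μ} ≥ 0` then
`s·E_{n+1}^{μ}(g) ≤ E_{n+1}^{B_s⊗μ}(ε ? g : κ·g)` (the criterion: `E_m(κ·g|_B) = (Π_B κ)·E_m(g|_B) ∈ [0, E_m(g|_B)]`). [this work] -/
theorem mul_sahiE_le_sahiE_coin_damped (μ : α → ℝ) {s : ℝ} (hs0 : 0 ≤ s) (hs1 : s ≤ 1) (g : Fin (n + 1) → α → ℝ)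
    (κ : Fin (n + 1) → ℝ) (hκ0 : ∀ l, 0 ≤ κ l) (hκ1 : ∀ l, κ l ≤ 1)
    (hpos : ∀ m, m ≤ n + 1 → ∀ e : Fin m → Fin (n + 1), StrictMono e → 0 ≤ sahiE μ m (fun j => g (e j))) :
    s * sahiE μ (n + 1) g ≤
      sahiE (fun z : Bool × α => if z.1 then s * μ z.2 else (1 - s) * μ z.2) (n + 1)
        (fun l (z : Bool × α) => if z.1 then g l z.2 else (κ l • g l) z.2) := by
  have hsm : ∀ m (e : Fin m → Fin (n + 1)), sahiE μ m (fun j => κ (e j) • g (e j)) = (∏ j, κ (e j)) * sahiE μ m (fun j => g (e j)) :=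
    fun m e => sahiE_smul_family μ (fun j => κ (e j)) (fun j => g (e j))
  have hP0 : ∀ m (e : Fin m → Fin (n + 1)), 0 ≤ ∏ j, κ (e j) := fun m e => prod_nonneg fun j _ => hκ0 (e j)
  have hP1 : ∀ m (e : Fin m → Fin (n + 1)), ∏ j, κ (e j) ≤ 1 := fun m e => prod_le_one (fun j _ => hκ0 (e j)) fun j _ => hκ1 (e j)
  refine mul_sahiE_le_sahiE_coin_pair μ hs0 hs1 g (fun l => κ l • g l) (fun m hm e he => ?_) (fun m hm e he => ?_) ?_
  · rw [hsm]; exact mul_nonneg (hP0 m e) (hpos m (Nat.le_succ_of_le hm) e he)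
  · rw [hsm]; exact mul_le_of_le_one_left (hpos m (Nat.le_succ_of_le hm) e he) (hP1 m e)
  · have h := hsm (n + 1) id
    simp only [id] at h
    rw [h]
    exact mul_nonneg (hP0 (n + 1) id) (hpos (n + 1) le_rfl id strictMono_id)

/-! ### §5 Sahi-positive weights and FKG lattices -/

/-- **Every vertex from Sahi positivity of order `n`** (finite preorder, nonnegative probability weight, nonnegative monotone functions).
[this work] -/
theorem mul_sahiE_le_sahiE_coin_vertex_of_sahiPositive [Preorder α] {μ : α → ℝ} (hμ₀ : ∀ x, 0 ≤ μ x) (hμ₁ : ∑ x, μ x = 1)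
    (hP : SahiPositive μ n) {s : ℝ} (hs0 : 0 ≤ s) (hs1 : s ≤ 1) (f : Fin (n + 1) → α → ℝ) (hf₀ : ∀ i x, 0 ≤ f i x)
    (hf : ∀ i, Monotone (f i)) (L : Finset (Fin (n + 1))) (hL : L.Nonempty) :
    s * sahiE μ (n + 1) f ≤
      sahiE (fun z : Bool × α => if z.1 then s * μ z.2 else (1 - s) * μ z.2) (n + 1)
        (fun l (z : Bool × α) => if z.1 then f l z.2 else if l ∈ L then 0 else f l z.2) :=
  mul_sahiE_le_sahiE_coin_vertex μ hs0 hs1 f L hL fun _ hm e _ => hP.anti hμ₀ hμ₁ hm _ (fun j x => hf₀ (e j) x) fun j => hf (e j)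

/-- **Every vertex, every order, for ARBITRARY UP-SETS of an FKG lattice that is Sahi-positive of order `n`** (event form:
`s·E_{n+1}(1_{U_l}) ≤ E_{n+1}^{B_s⊗ν}(F^L)`, `F^L_l = ε·1_{U_l}` for `l ∈ L`, `1_{U_l}` otherwise). [this work] -/
theorem mul_sahiE_le_sahiE_coin_vertex_of_isFKGMeasure [DistribLattice α] [DecidableEq α] {ν : α → ℝ} (hν : IsFKGMeasure ν)
    (hP : SahiPositive ν n) {s : ℝ} (hs0 : 0 ≤ s) (hs1 : s ≤ 1) (U : Fin (n + 1) → Finset α)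
    (hU : ∀ l, IsUpperSet (U l : Set α)) (L : Finset (Fin (n + 1))) (hL : L.Nonempty) :
    s * sahiE ν (n + 1) (fun l => setInd (U l)) ≤
      sahiE (fun z : Bool × α => if z.1 then s * ν z.2 else (1 - s) * ν z.2) (n + 1)
        (fun l (z : Bool × α) => if z.1 then setInd (U l) z.2 else if l ∈ L then 0 else setInd (U l) z.2) :=
  mul_sahiE_le_sahiE_coin_vertex_of_sahiPositive hν.nonneg hν.sum_eq_one hP hs0 hs1 _ (fun l x => setInd_nonneg (U l) x)
    (fun l => monotone_setInd (hU l)) L hL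

end

end Summit.CriticalPhenomena.PercolationContinuityZ3.Theorems.SahiTangent
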